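import Summits.QuantumFields.YangMills.Theorems.AtomicCalibrationRFarLevelMass
import Summits.QuantumFields.YangMills.Theorems.AtomicCalibrationRGevreyLeibniz

/-!
# AtomicCalibrationR (stmt-QuantumFields-28169), E2 `stub_offDiagonalWhitney` — far pieces and far level mass, factorial (Gevrey) rates
# (roadmap v3 item G.3, re-threading of `FarPiece` / `MassInputs` (far uniform) / `FarLevelMass`; prover w4 g22, free hands)

Same statements with the bump rate hypothesis weakened to `‖D^i b(z)‖ ≤ (i!)^s R^i`; the bounds pick up `(m!)^s`, the weights
`(N₁!)^s`:

* `norm_iteratedFDeriv_farPiece_le_factorial`, `norm_iteratedFDeriv_farPiece_uniform_le_factorial`, `far_level_mass_factorial`.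

No stub/crux/rung/summit is closed; nothing here touches Yang–Mills; the YM mass gap is NOT proved. [folklore]
-/

set_option autoImplicit false

noncomputable section

open scoped BigOperators ContDiff
open Set Metric Function
open Summit.QuantumFields.YangMills.Cruxes.AtomicCalibrationR.PairCutoff (pairCut)
open Summit.QuantumFields.YangMills.Cruxes.AtomicCalibrationR.GridPartition (gridBump gridCentre tsupport_gridBump_subset)
open Summit.QuantumFields.YangMills.Cruxes.AtomicCalibrationR.FarPiece (norm_iteratedFDeriv_le_schwartzNorm_div_mono)
open Summit.QuantumFields.YangMills.Cruxes.AtomicCalibrationR.PieceUniform (one_add_norm_centre_le)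
open Summit.QuantumFields.YangMills.Cruxes.AtomicCalibrationR.FarLevelMass (ncard_shell_le)
open Summit.QuantumFields.YangMills.Cruxes.AtomicCalibrationR.ShellSum (summable_of_shell_count tsum_le_of_shell_count)
open Summit.QuantumFields.YangMills.Cruxes.AtomicCalibrationR.GevreyLeibniz (norm_iteratedFDeriv_mul_le_of_flat_factorial)
open Literature.MathematicalPhysics.QuantumLattice (schwartzNorm schwartzNorm_nonneg schwartzNorm_mono)

namespace Summit.QuantumFields.YangMills.Cruxes.AtomicCalibrationR.GevreyFarLevelMass

/-- **Clause (v) for far pieces, factorial rates.** [folklore] -/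
theorem norm_iteratedFDeriv_farPiece_le_factorial {X : Type*} [NormedAddCommGroup X] [NormedSpace ℝ X] (F : SchwartzMap X ℂ)
    {G : X → ℝ} (hG : ContDiff ℝ ∞ G) (hGF : ∀ (j : ℕ) (w : X), ‖iteratedFDeriv ℝ j G w‖ ≤ ‖iteratedFDeriv ℝ j F w‖)
    {b : X → ℝ} (hb : ContDiff ℝ ∞ b) (k' m s : ℕ) {R : ℝ} (hR : 0 < R) (z : X)
    (hbR : ∀ i : ℕ, i ≤ m → ‖iteratedFDeriv ℝ i b z‖ ≤ ((Nat.factorial i : ℕ) : ℝ) ^ s * R ^ i) :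
    ‖iteratedFDeriv ℝ m (fun w => G w * b w) z‖ ≤
      ((Nat.factorial m : ℕ) : ℝ) ^ s * ((2 ^ max k' m * schwartzNorm (max k' m) F / (1 + ‖z‖) ^ k') * (1 + R) ^ m) := by
  set P : ℝ := 2 ^ max k' m * schwartzNorm (max k' m) F / (1 + ‖z‖) ^ k' with hP
  have hP0 : 0 ≤ P := by have := schwartzNorm_nonneg (max k' m) F; positivity
  have hFb : ∀ j : ℕ, j ≤ m → ‖iteratedFDeriv ℝ j G z‖ ≤ P * (1 : ℝ) ^ (m - j) := by
    intro j hj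
    rw [one_pow, mul_one]
    exact (hGF j z).trans (norm_iteratedFDeriv_le_schwartzNorm_div_mono F k' m hj z)
  have hΦb : ∀ i : ℕ, i ≤ m → ‖iteratedFDeriv ℝ i b z‖ ≤ 1 * ((Nat.factorial i : ℕ) : ℝ) ^ s * R⁻¹⁻¹ ^ i := by
    intro i hi; rw [inv_inv, one_mul]; exact hbR i hi
  have h := norm_iteratedFDeriv_mul_le_of_flat_factorial (A := ℝ) hG hb le_rfl hP0 zero_le_one zero_le_one (inv_pos.2 hR) s z
    hFb hΦb
  refine h.trans (le_of_eq ?_)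
  rw [Nat.sub_self, pow_zero, mul_one, mul_one, one_div, inv_inv]

variable {n : ℕ}

/-- **Clause (v), uniform form, far pieces, factorial rates.** [folklore] -/
theorem norm_iteratedFDeriv_farPiece_uniform_le_factorial (F : SchwartzMap (Fin n → EuclideanSpace ℝ (Fin 4)) ℂ)
    {G : (Fin n → EuclideanSpace ℝ (Fin 4)) → ℝ} (hG : ContDiff ℝ ∞ G)
    (hGF : ∀ (j : ℕ) (w : Fin n → EuclideanSpace ℝ (Fin 4)), ‖iteratedFDeriv ℝ j G w‖ ≤ ‖iteratedFDeriv ℝ j F w‖)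
    {φ : ℝ → ℝ} (hφ : ContDiff ℝ ∞ φ) (hφs : tsupport φ ⊆ Icc (-1 : ℝ) 1) {h : ℝ} (hh : 0 < h) (hh2 : 2 * h ≤ 1 / 2)
    (c : Fin n × Fin 4 → ℤ) (k' m s : ℕ) {R : ℝ} (hR : 0 < R)
    (hb : ∀ (z : Fin n → EuclideanSpace ℝ (Fin 4)) (i : ℕ), i ≤ m →
      ‖iteratedFDeriv ℝ i (fun w => pairCut n 0 w * gridBump φ n h c w) z‖ ≤ ((Nat.factorial i : ℕ) : ℝ) ^ s * R ^ i)
    (z : Fin n → EuclideanSpace ℝ (Fin 4)) :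
    ‖iteratedFDeriv ℝ m (fun w => G w * (pairCut n 0 w * gridBump φ n h c w)) z‖ ≤
      ((Nat.factorial m : ℕ) : ℝ) ^ s *
        (2 ^ max k' m * 2 ^ k' * schwartzNorm (max k' m) F / (1 + ‖gridCentre n h c‖) ^ k' * (2 * h * (1 + R)) ^ m) /
        (2 * h) ^ m := by
  have hS : 0 ≤ schwartzNorm (max k' m) F := schwartzNorm_nonneg _ _
  have h2h : 0 < 2 * h := by linarith
  have hRHS : 0 ≤ ((Nat.factorial m : ℕ) : ℝ) ^ s *
      (2 ^ max k' m * 2 ^ k' * schwartzNorm (max k' m) F / (1 + ‖gridCentre n h c‖) ^ k' * (2 * h * (1 + R)) ^ m) /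
      (2 * h) ^ m := by positivity
  have hb_smooth : ContDiff ℝ ∞ (fun w => pairCut n 0 w * gridBump φ n h c w) :=
    (Summit.QuantumFields.YangMills.Cruxes.AtomicCalibrationR.PairCutoff.contDiff_pairCut n 0).mul
      (Summit.QuantumFields.YangMills.Cruxes.AtomicCalibrationR.GridPartition.contDiff_gridBump hφ n h c)
  by_cases hz : z ∈ tsupport (fun w => G w * (pairCut n 0 w * gridBump φ n h c w))
  · have hcube : ∀ l, ‖z l - gridCentre n h c l‖ ≤ 2 * h := by
      have hsub : tsupport (fun w => G w * (pairCut n 0 w * gridBump φ n h c w)) ⊆ tsupport (gridBump φ n h c) :=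
        (tsupport_mul_subset_right (f := fun w => G w) (g := fun w => pairCut n 0 w * gridBump φ n h c w)).trans
          (tsupport_mul_subset_right (f := fun w => pairCut n 0 w) (g := gridBump φ n h c))
      exact tsupport_gridBump_subset hφs n hh c (hsub hz)
    have hcmp := one_add_norm_centre_le hh hh2 c hcube
    have h1 := norm_iteratedFDeriv_farPiece_le_factorial F hG hGF hb_smooth k' m s hR z (hb z)
    refine h1.trans ?_
    have hdec : 2 ^ max k' m * schwartzNorm (max k' m) F / (1 + ‖z‖) ^ k' ≤
        2 ^ max k' m * 2 ^ k' * schwartzNorm (max k' m) F / (1 + ‖gridCentre n h c‖) ^ k' := by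
      rw [div_le_div_iff₀ (by positivity) (by positivity)]
      have hpow : (1 + ‖gridCentre n h c‖) ^ k' ≤ 2 ^ k' * (1 + ‖z‖) ^ k' := by
        rw [← mul_pow]; exact pow_le_pow_left₀ (by positivity) hcmp k'
      calc 2 ^ max k' m * schwartzNorm (max k' m) F * (1 + ‖gridCentre n h c‖) ^ k'
          ≤ 2 ^ max k' m * schwartzNorm (max k' m) F * (2 ^ k' * (1 + ‖z‖) ^ k') :=
            mul_le_mul_of_nonneg_left hpow (by positivity)
        _ = 2 ^ max k' m * 2 ^ k' * schwartzNorm (max k' m) F * (1 + ‖z‖) ^ k' := by ring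
    have hRm : (1 + R) ^ m = (2 * h * (1 + R)) ^ m / (2 * h) ^ m := by
      rw [mul_pow, mul_comm, mul_div_assoc, div_self (pow_ne_zero _ h2h.ne'), mul_one]
    rw [hRm, ← mul_div_assoc, ← mul_div_assoc]
    refine div_le_div_of_nonneg_right ?_ (by positivity)
    exact mul_le_mul_of_nonneg_left (mul_le_mul_of_nonneg_right hdec (by positivity)) (by positivity)
  · have h0 : iteratedFDeriv ℝ m (fun w => G w * (pairCut n 0 w * gridBump φ n h c w)) z = 0 := by
      by_contra hne
      exact hz (support_iteratedFDeriv_subset m (mem_support.2 hne))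
    rw [h0, norm_zero]
    exact hRHS

/-- **Mass of the far level** (clauses (v) + (vi) for the far pieces).  See the module docstring. [folklore] -/
theorem far_level_mass_factorial (F : SchwartzMap (Fin n → EuclideanSpace ℝ (Fin 4)) ℂ)
    {G : (Fin n → EuclideanSpace ℝ (Fin 4)) → ℝ} (hG : ContDiff ℝ ∞ G)
    (hGF : ∀ (j : ℕ) (w : Fin n → EuclideanSpace ℝ (Fin 4)), ‖iteratedFDeriv ℝ j G w‖ ≤ ‖iteratedFDeriv ℝ j F w‖)
    {φ : ℝ → ℝ} (hφ : ContDiff ℝ ∞ φ) (hφs : tsupport φ ⊆ Icc (-1 : ℝ) 1) {h : ℝ} (hh : 0 < h) (hh2 : 2 * h ≤ 1 / 2)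
    (N₁ s : ℕ) {R : ℝ} (hR : 0 < R)
    (hb : ∀ (c : Fin n × Fin 4 → ℤ) (z : Fin n → EuclideanSpace ℝ (Fin 4)) (i : ℕ), i ≤ N₁ →
      ‖iteratedFDeriv ℝ i (fun w => pairCut n 0 w * gridBump φ n h c w) z‖ ≤ ((Nat.factorial i : ℕ) : ℝ) ^ s * R ^ i) :
    ∃ M : (Fin n × Fin 4 → ℤ) → ℝ, (∀ c, 0 ≤ M c) ∧ Summable M ∧
      ∑' c, M c ≤ 2 ^ (4 * n + 1) * (3 / h) ^ (4 * n) *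
        (((Nat.factorial N₁ : ℕ) : ℝ) ^ s * (2 ^ max (4 * n + 2) N₁ * 2 ^ (4 * n + 2) * schwartzNorm (max (4 * n + 2) N₁) F *
          max 1 (2 * h * (1 + R)) ^ N₁)) ∧
      ∀ (c : Fin n × Fin 4 → ℤ) (m : ℕ), m ≤ N₁ → ∀ z : Fin n → EuclideanSpace ℝ (Fin 4),
        ‖iteratedFDeriv ℝ m (fun w => G w * (pairCut n 0 w * gridBump φ n h c w)) z‖ ≤ M c / (2 * h) ^ m := by
  classical
  set k' : ℕ := 4 * n + 2 with hk'
  set B : ℝ := ((Nat.factorial N₁ : ℕ) : ℝ) ^ s * (2 ^ max k' N₁ * 2 ^ k' * schwartzNorm (max k' N₁) F *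
    max 1 (2 * h * (1 + R)) ^ N₁) with hB
  have hS : 0 ≤ schwartzNorm (max k' N₁) F := schwartzNorm_nonneg _ _
  have hB0 : 0 ≤ B := by positivity
  have hh1 : h ≤ 1 := by linarith
  have h2h : 0 < 2 * h := by linarith
  let M : (Fin n × Fin 4 → ℤ) → ℝ := fun c => B / (1 + ‖gridCentre n h c‖) ^ k'
  have hM0 : ∀ c, 0 ≤ M c := fun c => by positivity
  have hMle : ∀ c, M c ≤ B / (1 + ‖gridCentre n h c‖) ^ (4 * n + 2) := fun c => le_rfl
  have hfin : ∀ a : ℕ, {c : Fin n × Fin 4 → ℤ | ⌊‖gridCentre n h c‖⌋₊ = a}.Finite := fun a => (ncard_shell_le hh hh1 a).1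
  have hcount : ∀ a : ℕ, (({c : Fin n × Fin 4 → ℤ | ⌊‖gridCentre n h c‖⌋₊ = a}.ncard : ℕ) : ℝ) ≤
      (3 / h) ^ (4 * n) * (2 + a) ^ (4 * n) := fun a => (ncard_shell_le hh hh1 a).2
  have hA0 : (0 : ℝ) ≤ (3 / h) ^ (4 * n) := by positivity
  refine ⟨M, hM0, ?_, ?_, ?_⟩
  · exact summable_of_shell_count (fun c => ‖gridCentre n h c‖) M (fun c => norm_nonneg _) hM0 hA0 hB0 hfin hcount hMle
  · have := tsum_le_of_shell_count (fun c => ‖gridCentre n h c‖) M (fun c => norm_nonneg _) hM0 hA0 hB0 hfin hcount hMle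
    exact this
  · intro c m hm z
    have h1 := norm_iteratedFDeriv_farPiece_uniform_le_factorial F hG hGF hφ hφs hh hh2 c k' m s hR
      (fun z i hi => hb c z i (hi.trans hm)) z
    refine h1.trans (div_le_div_of_nonneg_right ?_ (by positivity))
    -- monotonicity in `m`
    have hle : max k' m ≤ max k' N₁ := max_le_max le_rfl hm
    have h2pow : (2 : ℝ) ^ max k' m ≤ 2 ^ max k' N₁ := pow_le_pow_right₀ (by norm_num) hle
    have hSm : schwartzNorm (max k' m) F ≤ schwartzNorm (max k' N₁) F := schwartzNorm_mono hle F
    have hSm0 : 0 ≤ schwartzNorm (max k' m) F := schwartzNorm_nonneg _ _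
    have hpow2 : (2 * h * (1 + R)) ^ m ≤ max 1 (2 * h * (1 + R)) ^ N₁ :=
      (pow_le_pow_left₀ (by positivity) (le_max_right _ _) m).trans (pow_le_pow_right₀ (le_max_left _ _) hm)
    have hden : 0 < (1 + ‖gridCentre n h c‖) ^ k' := by positivity
    have hfacm : ((Nat.factorial m : ℕ) : ℝ) ^ s ≤ ((Nat.factorial N₁ : ℕ) : ℝ) ^ s :=
      pow_le_pow_left₀ (by positivity) (by exact_mod_cast Nat.factorial_le hm) s
    show ((Nat.factorial m : ℕ) : ℝ) ^ s *
        (2 ^ max k' m * 2 ^ k' * schwartzNorm (max k' m) F / (1 + ‖gridCentre n h c‖) ^ k' * (2 * h * (1 + R)) ^ m) ≤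
      B / (1 + ‖gridCentre n h c‖) ^ k'
    rw [hB, div_mul_eq_mul_div, ← mul_div_assoc, div_le_div_iff_of_pos_right hden]
    calc ((Nat.factorial m : ℕ) : ℝ) ^ s * (2 ^ max k' m * 2 ^ k' * schwartzNorm (max k' m) F * (2 * h * (1 + R)) ^ m)
        ≤ ((Nat.factorial N₁ : ℕ) : ℝ) ^ s *
          (2 ^ max k' N₁ * 2 ^ k' * schwartzNorm (max k' N₁) F * max 1 (2 * h * (1 + R)) ^ N₁) := by
          refine mul_le_mul hfacm ?_ (by positivity) (by positivity)
          refine mul_le_mul (mul_le_mul (mul_le_mul_of_nonneg_right h2pow (by positivity)) hSm hSm0 (by positivity))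
            hpow2 (by positivity) (by positivity)

end Summit.QuantumFields.YangMills.Cruxes.AtomicCalibrationR.GevreyFarLevelMass

end
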